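import Literature.Probability.Percolation.CerfCentralInequality
import Literature.Probability.Percolation.SiteExploration
import HarnessLib

/-!
# Cerf 2015, Proposition 4.1: proof

Topic `Literature/Probability/Percolation`. Sorry-free discharge of the named fact
`Cerf2015_prop_4_1` (the large deviation estimate for Cerf's statistic `h` of an explored
cluster) of `CerfCentralInequality.lean`. R. Cerf, *A lower bound on the two-arms exponent
for critical percolation on the lattice*, Ann. Probab. 43 (2015) 2458–2480, arXiv:1306.3105,
§4 (p. 7).

## Proposition 4.1 (p. 7), as formalised

Condition on the configuration `η` outside `Λ(n)` (a finite partition of the sample space by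
the events `A_η = {ω ∩ (L ∖ Λ(n)) = η}`, `L = Λ(n+ℓ)`), and on `A_η` run Cerf's growth
algorithm `clusterExplore` (`SiteExploration.lean`): by `clusterExplore_spec` it queries
exactly the `k = |C̄(x) ∩ Λ(n)|` sites of `C̄(x) ∩ Λ(n)` and finds exactly the
`O = |C(x) ∩ Λ(n)|` sites of `C(x) ∩ Λ(n)` open, while `h(C̄(x) ∩ Λ(n)) = (pk − O)/(p(1−p))`;
Hoeffding's inequality for adaptively revealed sites
(`sitePercolation_real_exploration_deviation_le`, with `s = p(1−p)t`) bounds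
`P(A_η ∩ {|h| ≥ t, |C̄ ∩ Λ(n)| = k}) ≤ 2 e^{−2p²(1−p)²t²/k} P(A_η)`, and one sums over `η`.

## Main results

* `real_cerfH_deviation_le`: Prop. 4.1 for an arbitrary graph and finite `Λ ⊆ L`;
* `Cerf2015_prop_4_1_holds : Cerf2015_prop_4_1`.
-/

noncomputable section

open MeasureTheory Filter Topology Literature.Probability.LatticeModels Literature.Probability.Percolation Literature.Probability.Percolation.SiteDecisionTree

namespace Literature.Probability.Percolation

section CritPerc

variable {V : Type*} {d : ℕ}

/-! ### Proposition 4.1 -/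

section Prop41

variable {G : SimpleGraph V}

open Classical in
/-- The open sites of `C̄_L(x) ∩ Λ` are the sites of `C_L(x) ∩ Λ` (for `Λ ⊆ L`).
[cite: Cerf2015, §4 (p. 7)] -/
theorem clusterClosureIn_filter_mem {L Λ : Finset V} (hΛL : Λ ⊆ L) (ω : SiteConfig V) (x : V) :
    (clusterClosureIn G L Λ ω x).filter (fun y => y ∈ ω) =
      Λ.filter fun y => y ∈ siteClusterIn G ↑L ω x := by
  ext y
  simp only [Finset.mem_filter, mem_clusterClosureIn_iff]
  constructor
  · rintro ⟨⟨hyΛ, hy | ⟨z, hz, hzy⟩⟩, hyω⟩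
    · exact ⟨hyΛ, hy⟩
    · exact ⟨hyΛ, mem_siteClusterIn_of_adj hz hzy hyω (Finset.mem_coe.2 (hΛL hyΛ))⟩
  · rintro ⟨hyΛ, hy⟩
    exact ⟨⟨hyΛ, Or.inl hy⟩, (mem_open_of_mem_siteClusterIn hy).1⟩

open Classical in
/-- **Cerf's identity for `h`** (p. 7): `h(C̄(x) ∩ Λ) = (p k − O)/(p(1−p))` with
`k = |C̄(x) ∩ Λ|` and `O = |C(x) ∩ Λ|`. [cite: Cerf2015, §4 (p. 7)] -/
theorem cerfH_clusterClosureIn {p : ℝ} (hp0 : p ≠ 0) (hp1 : 1 - p ≠ 0) {L Λ : Finset V}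
    (hΛL : Λ ⊆ L) (ω : SiteConfig V) (x : V) :
    cerfH p ω (clusterClosureIn G L Λ ω x) =
      (p * (clusterClosureIn G L Λ ω x).card -
        (Λ.filter fun y => y ∈ siteClusterIn G ↑L ω x).card) / (p * (1 - p)) := by
  have hsum := Finset.card_filter_add_card_filter_not
    (s := clusterClosureIn G L Λ ω x) (fun y => y ∈ ω)
  rw [clusterClosureIn_filter_mem hΛL] at hsum
  have hclosed : (((clusterClosureIn G L Λ ω x).filter fun y => y ∉ ω).card : ℝ) =
      (clusterClosureIn G L Λ ω x).card -
        (Λ.filter fun y => y ∈ siteClusterIn G ↑L ω x).card := by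
    have : (((Λ.filter fun y => y ∈ siteClusterIn G ↑L ω x).card +
        ((clusterClosureIn G L Λ ω x).filter fun y => y ∉ ω).card : ℕ) : ℝ) =
        (clusterClosureIn G L Λ ω x).card := by exact_mod_cast hsum
    push_cast at this
    linarith
  unfold cerfH
  rw [hclosed, clusterClosureIn_filter_mem hΛL]
  field_simp
  ring

/-- **Cerf 2015, Proposition 4.1 for a general graph**: for finite `Λ ⊆ L`, any site `x`,
`k ≥ 1`, `t ≥ 0` and `0 < p < 1`,
`P_p(|h(C̄_L(x) ∩ Λ)| ≥ t, |C̄_L(x) ∩ Λ| = k) ≤ 2 exp(−2p²(1−p)²t²/k)`.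
[cite: Cerf2015, Prop 4.1] -/
theorem real_cerfH_deviation_le [DecidableEq V] (p : unitInterval) (hp0 : 0 < (p : ℝ))
    (hp1 : (p : ℝ) < 1) {L Λ : Finset V} (hΛL : Λ ⊆ L) (x : V) {k : ℕ} (hk : 1 ≤ k) {t : ℝ} (ht : 0 ≤ t) :
    (sitePercolation V p).real
        {ω | t ≤ |cerfH p ω (clusterClosureIn G L Λ ω x)| ∧
          (clusterClosureIn G L Λ ω x).card = k} ≤
      2 * Real.exp (-2 * (p : ℝ) ^ 2 * (1 - p) ^ 2 * t ^ 2 / k) := by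
  classical
  set μ := sitePercolation V p with hμ
  set U : Finset V := L \ Λ with hU
  have hp1' : 0 < 1 - (p : ℝ) := by linarith
  set s : ℝ := (p : ℝ) * (1 - p) * t with hs
  have hs0 : 0 ≤ s := by positivity
  set E : Set (SiteConfig V) := {ω | t ≤ |cerfH p ω (clusterClosureIn G L Λ ω x)| ∧
    (clusterClosureIn G L Λ ω x).card = k} with hE
  -- the partition according to the configuration outside `Λ`
  set A : Finset V → Set (SiteConfig V) := fun η => {ω | ∀ v ∈ U, v ∈ ω ↔ v ∈ η} with hA
  have hAdet : ∀ η, DeterminedBy (A η) ↑U := by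
    intro η
    rw [determinedBy_iff]
    intro ω ω' h
    have key : ∀ v ∈ U, (v ∈ ω ↔ v ∈ ω') := fun v hv => by
      have := Set.ext_iff.1 h v
      simp only [Set.mem_inter_iff, Finset.mem_coe] at this
      exact ⟨fun h1 => (this.1 ⟨h1, hv⟩).1, fun h1 => (this.2 ⟨h1, hv⟩).1⟩
    simp only [hA, Set.mem_setOf_eq]
    exact forall₂_congr fun v hv => by rw [key v hv]
  have hAmeas : ∀ η ∈ U.powerset, MeasurableSet (A η) := fun η _ =>
    (hAdet η).measurableSet_of_finset
  have hAdisj : (↑U.powerset : Set (Finset V)).PairwiseDisjoint A := by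
    intro η hη η' hη' hne
    rw [Function.onFun, Set.disjoint_left]
    intro ω h1 h2
    apply hne
    have hηU := Finset.mem_powerset.1 (Finset.mem_coe.1 hη)
    have hη'U := Finset.mem_powerset.1 (Finset.mem_coe.1 hη')
    ext v
    constructor
    · intro hv; exact (h2 v (hηU hv)).1 ((h1 v (hηU hv)).2 hv)
    · intro hv; exact (h1 v (hη'U hv)).1 ((h2 v (hη'U hv)).2 hv)
  have hcover : E ⊆ ⋃ η ∈ U.powerset, E ∩ A η := by
    intro ω hω
    simp only [Set.mem_iUnion, exists_prop]
    refine ⟨U.filter (fun v => v ∈ ω), Finset.mem_powerset.2 (Finset.filter_subset _ _), hω, ?_⟩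
    intro v hv
    simp [Finset.mem_filter, hv]
  -- each piece: run the growth algorithm
  have hpiece : ∀ η ∈ U.powerset,
      μ.real (E ∩ A η) ≤ 2 * Real.exp (-2 * s ^ 2 / k) * μ.real (A η) := by
    intro η hη
    have hηU : η ⊆ L \ Λ := Finset.mem_powerset.1 hη
    set T := clusterExplore G L Λ η x Λ.card ∅ ∅ with hT
    have hTf : T.Fresh ↑U := by
      refine clusterExplore_fresh _ _ _ ?_
      rintro v ⟨hvU, hvΛ⟩
      exact absurd (Finset.mem_coe.1 hvΛ) (Finset.mem_sdiff.1 (Finset.mem_coe.1 hvU)).2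
    have hTs : T.Supported ↑Λ := clusterExplore_supported _ _ _
    have hsub : E ∩ A η ⊆ A η ∩ {ω | T.length ω = k ∧ s ≤ |(T.openCount ω : ℝ) - p * k|} := by
      rintro ω ⟨⟨htω, hcard⟩, hAω⟩
      refine ⟨hAω, ?_⟩
      have hagree : ∀ v ∈ L, v ∉ Λ → (v ∈ ω ↔ v ∈ η) := fun v hvL hvΛ =>
        hAω v (Finset.mem_sdiff.2 ⟨hvL, hvΛ⟩)
      have hxω : x ∈ ω := by
        by_contra hxω
        rw [clusterClosureIn_eq_empty hxω, Finset.card_empty] at hcard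
        omega
      obtain ⟨h1, h2⟩ := clusterExplore_spec (G := G) hΛL hηU hagree hxω Λ.card ∅ ∅
        (by simp) (by simp) (by simp)
      have hK : (Λ.filter fun y => y ∈ siteClusterIn G ↑L ω x ∨
          ∃ z ∈ siteClusterIn G ↑L ω x, G.Adj z y) = clusterClosureIn G L Λ ω x := rfl
      rw [Finset.union_empty, Finset.card_empty, add_zero, hK, hcard] at h1
      rw [Finset.card_empty, add_zero] at h2
      refine ⟨h1, ?_⟩
      have hh := cerfH_clusterClosureIn hp0.ne' hp1'.ne' hΛL ω x (G := G)
      rw [hcard] at hh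
      have hpq : 0 < (p : ℝ) * (1 - p) := mul_pos hp0 hp1'
      rw [hh, abs_div, abs_of_pos hpq, le_div_iff₀ hpq] at htω
      rw [h2]
      calc s = t * ((p : ℝ) * (1 - p)) := by rw [hs]; ring
        _ ≤ |(p : ℝ) * k - ((Λ.filter fun y => y ∈ siteClusterIn G ↑L ω x).card : ℝ)| := htω
        _ = _ := abs_sub_comm _ _
    calc μ.real (E ∩ A η)
        ≤ μ.real (A η ∩ {ω | T.length ω = k ∧ s ≤ |(T.openCount ω : ℝ) - p * k|}) :=
          measureReal_mono hsub (measure_ne_top _ _)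
      _ ≤ 2 * Real.exp (-2 * s ^ 2 / k) * μ.real (A η) :=
          sitePercolation_real_exploration_deviation_le p hTf hTs (hAdet η) k hs0
  have hsum1 : ∑ η ∈ U.powerset, μ.real (A η) ≤ 1 :=
    (sum_measureReal_le_measureReal_univ hAmeas hAdisj).trans (by rw [probReal_univ])
  calc μ.real E ≤ μ.real (⋃ η ∈ U.powerset, E ∩ A η) := measureReal_mono hcover (measure_ne_top _ _)
    _ ≤ ∑ η ∈ U.powerset, μ.real (E ∩ A η) := measureReal_biUnion_finset_le _ _
    _ ≤ ∑ η ∈ U.powerset, 2 * Real.exp (-2 * s ^ 2 / k) * μ.real (A η) :=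
        Finset.sum_le_sum hpiece
    _ = 2 * Real.exp (-2 * s ^ 2 / k) * ∑ η ∈ U.powerset, μ.real (A η) := by
        rw [Finset.mul_sum]
    _ ≤ 2 * Real.exp (-2 * s ^ 2 / k) * 1 :=
        mul_le_mul_of_nonneg_left hsum1 (by positivity)
    _ = 2 * Real.exp (-2 * (p : ℝ) ^ 2 * (1 - p) ^ 2 * t ^ 2 / k) := by
        rw [mul_one, hs]; congr 2; ring

end Prop41

/-- **Cerf 2015, Proposition 4.1, discharged.** [cite: Cerf2015, Prop 4.1] -/
theorem Cerf2015_prop_4_1_holds : Cerf2015_prop_4_1 := by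
  intro d p hp0 hp1 n ℓ _ x _ k hk t ht
  exact real_cerfH_deviation_le p hp0 hp1 (box_mono d (Nat.le_add_right n ℓ)) x hk ht

end CritPerc

end Literature.Probability.Percolation
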